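import Summits.CriticalPhenomena.SAWScalingLimit.Theorems.SAWLoopFugacityFlowIsingBoundaryRatioRSWDefs
import HarnessLib

/-!
# Definitions for the mesh-graph RSW residual of the line `fk-anchor-transfer`
(crux `SAWLoopFugacityFlow.IsingBoundaryRatio`, stmt-CriticalPhenomena-10650)

A small definitions module next to `…IsingBoundaryRatioRSWDefs.lean` (imported, NOT modified), naming the
objects through which the registered stub `stub_roughHalfAnnulusRSWMesh : RoughHalfAnnulusRSWMeshOf AnnPathSepG`
(critical FK-Ising crossing bounds in the lattice conformal half-annuli `φ({ρ < |w| < Mρ})` at the rough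
marked prime end `a = φ(0)` of a Jordan domain, mesh graph `Ω_δ`, extremal boundary conditions) is
decomposed in `…IsingBoundaryRatioRoughHalfAnnulusRSWMesh.lean` into one planar-topology statement and two
instances of Chelkak–Duminil-Copin–Hongler 2016, Thm 1.1:

* `annWindow D φ M ε δ ρ r₁ r₂ Λ` — the sites of the lattice half-annulus `annBody` with chart radius in
  the window `[r₁, r₂] ⊆ (ρ, Mρ)`; `annSide D φ M ε δ ρ r₁ r₂ Λ left` — its LEFT (`left = true`, chart
  point in `{re < 0}`, next to the arc `φ((-Mρ,-ρ))` of `∂D`) or RIGHT rough side: window sites that are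
  boundary vertices of `Ω_δ` (`meshBoundary`: a `ℤ²`-neighbour is not joined to them in `Ω_δ`, so they
  sit within `δ` of `∂D`, whose chart image is `ℝ`). The window must stay away from the rims `ρ`, `Mρ`:
  the chart radius is continuous but in no way monotone at the lattice scale near the rough boundary, so
  an open path of annulus sites may have EDGES whose chart image dips into `{|w| < ρ}` (or ends at a
  boundary defect sitting exactly at a corner `φ(±ρ)`), leaving sites of `annIn` on its far side, free
  to reach the outside — the unwindowed separation statement is false; with a margin, for small `δ` the
  chart oscillation over one edge is below the margin and nothing dips;
* `AnnSideCross H W L R ω` — an `ω`-open walk of `H` inside `W` from a site of `L` to a site of `R`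
  (with `W` the window and `L`, `R` its rough sides: the event "the rough sides are joined inside the
  window", CDH16's `(ab) ↔ (cd)` for a discrete rectangle carved out of the window);
* `AnnSideCrossSeparation` — TARGET (planar topology of `Ω_δ ⊆ δℤ²` in the chordal chart, no
  probability): for small mesh an open side-to-side crossing of the windowed annulus is an `AnnPathSep`
  separator, i.e. its support meets every walk of `H` from `annIn` to the complement of `annIn ∪ annBody`
  (route: prolong the polyline of the crossing at both ends by mesh-avoiding access paths
  `Mesh.exists_accessPath` up to `∂D`, and pull back by the Carathéodory extension of `φ⁻¹`: a curve in
  the closed chart half-annulus `{ρ ≤ |w| ≤ Mρ, im w ≥ 0}` from `ℝ₋` to `ℝ₊`; the polyline of a walk from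
  `annIn` to the outside, trimmed, pulls back to a curve from `{|w| = ρ}` to `{|w| = Mρ}` in the same
  set; in the coordinates `(log |w|, arg w)` this is a rectangle and the two curves meet (Maehara's
  crossing lemma, `Literature.Topology.PlaneTopology.exists_mem_of_crossing`); a common point is a
  common lattice vertex, as two closed edges of `δℤ²` meet only at a common endpoint and the access
  paths avoid the mesh — touching of `∂D` by either curve is harmless);
* `ChartDiscOneComponent` — TARGET (lattice topology of `Ω_δ` at the marked prime end, no probability):
  for `ε > 0` there is `R₀ > 0` such that for `R < R₀` and small `δ` any two vertices of `Ω_δ` of chart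
  radius `< R` are joined by a walk of `Ω_δ` all of whose vertices have mesh point in `B(a, ε)` (one
  ball-component: necks of `∂D` narrower than `δ` cut off only bays, whose sites leave the largest mesh
  component; a second component creeping along a rough arc of `∂D` would need `∂D` between it and the
  bulk, i.e. the arc itself, whose chart height is `0`). It converts the guard `AnnLink` of the stub (some
  walk of `H = Ω_δ|_Λ` joins the inside to the outside, so `Λ` holds a vertex of `Ω_δ` of chart radius
  `≤ ρ`; by `LocalAgreement` `Λ` is closed under `Ω_δ`-neighbours inside `B(a, ε)`) into "`Λ` contains
  every vertex of `Ω_δ` of chart radius `< Mρ`" (`roughHalfAnnulusRSWMesh_of_bounds`);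
* `HalfAnnulusSideCrossingBound` — TARGET (CDH16 Thm 1.1 (i) + Remark 2.2, free measure, for the discrete
  topological rectangle carved out of the annulus sites with the rough sides as marked arcs, whose
  discrete extremal length is bounded in terms of `M` once `δ` is small: Chelkak's toolbox Prop. 6.2 /
  Cor. 6.3): under the FREE critical FK-Ising measure of the local graph `⟨U⟩`, `U` = edges of `Ω_δ|_Λ`
  touching the annulus, the side-to-side crossing of the window `[M^{1/4} ρ, M^{3/4} ρ]` has probability
  `≥ c(M) > 0`, for every finite volume `Λ` containing all vertices of `Ω_δ` of chart radius `< Mρ` (so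
  that `H = Ω_δ|_Λ` carries the whole lattice half-annulus: the canonical instance);
* `HalfAnnulusRimCrossingBound` — TARGET (CDH16 Thm 1.1 (ii) + Remark 2.2, wired measure, rims as marked
  arcs): under the measure of `⟨U⟩` with all vertices off the annulus wired, the open radial crossing
  `AnnCross` has probability `≤ 1 - c(M)`.

`roughHalfAnnulusRSWMesh_of_bounds` (file `…RoughHalfAnnulusRSWMesh.lean`) proves
`AnnSideCrossSeparation → ChartDiscOneComponent → HalfAnnulusSideCrossingBound →
HalfAnnulusRimCrossingBound → RoughHalfAnnulusRSWMeshOf AnnPathSepG`. Every proposition named here is a TARGET of the line, not a cited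
fact; nothing is asserted. Sources for the shape of the statements: D. Chelkak, H. Duminil-Copin,
C. Hongler, *Crossing probabilities in topological rectangles for the critical planar FK-Ising model*,
EJP 21 (2016), Thm 1.1, Rem. 2.2 (arXiv:1312.7785); D. Chelkak, *Robust discrete complex analysis: a
toolbox*, Ann. Probab. 44 (2016), Prop. 6.2, Cor. 6.3; R. Maehara, *The Jordan curve theorem via the
Brouwer fixed point theorem*, Amer. Math. Monthly 91 (1984), Lemma (crossing paths of a rectangle meet).
-/

noncomputable section

open scoped Classical Topology
open Filter Set Metric SimpleGraph
open Literature.Probability.LatticeModels Literature.Probability.RandomPlanarGeometry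
open Literature.Probability.Percolation (BondConfig)
open UpperHalfPlane (upperHalfPlaneSet)

namespace Summit.CriticalPhenomena.SAWScalingLimit.Theorems.IsingBoundaryRatio

section Events

variable {Λ : Finset (Site 2)}

/-- **The window** `[r₁, r₂]` of the lattice conformal half-annulus: the sites of `annBody` with chart
radius in `[r₁, r₂]`. [folklore] -/
def annWindow (D : DobrushinDomain) (φ : ConformalEquiv upperHalfPlaneSet D.carrier)
    (M ε δ ρ r₁ r₂ : ℝ) (Λ : Finset (Site 2)) : Set Λ :=
  {v | v ∈ annBody D φ M ε δ ρ Λ ∧ r₁ ≤ ‖φ.symm (meshPoint δ v.1)‖ ∧ ‖φ.symm (meshPoint δ v.1)‖ ≤ r₂}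

/-- **A rough side of the window**: the window sites that are boundary vertices of the mesh graph `Ω_δ`
(`meshBoundary`), on the left (`left = true`: chart point in `{re < 0}`, next to the boundary arc
`φ((-Mρ, -ρ))`) or on the right (`left = false`: `{0 < re}`, next to `φ((ρ, Mρ))`). [folklore] -/
def annSide (D : DobrushinDomain) (φ : ConformalEquiv upperHalfPlaneSet D.carrier)
    (M ε δ ρ r₁ r₂ : ℝ) (Λ : Finset (Site 2)) (left : Bool) : Set Λ :=
  {v | v ∈ annWindow D φ M ε δ ρ r₁ r₂ Λ ∧ v.1 ∈ meshBoundary D.carrier δ ∧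
    (if left then (φ.symm (meshPoint δ v.1)).re < 0 else 0 < (φ.symm (meshPoint δ v.1)).re)}

/-- The window lies in the annulus. [folklore] -/
theorem annWindow_subset_annBody (D : DobrushinDomain) (φ : ConformalEquiv upperHalfPlaneSet D.carrier)
    (M ε δ ρ r₁ r₂ : ℝ) (Λ : Finset (Site 2)) :
    annWindow D φ M ε δ ρ r₁ r₂ Λ ⊆ annBody D φ M ε δ ρ Λ :=
  fun _ hv => hv.1

/-- A rough side lies in the window. [folklore] -/
theorem annSide_subset_annWindow (D : DobrushinDomain) (φ : ConformalEquiv upperHalfPlaneSet D.carrier)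
    (M ε δ ρ r₁ r₂ : ℝ) (Λ : Finset (Site 2)) (left : Bool) :
    annSide D φ M ε δ ρ r₁ r₂ Λ left ⊆ annWindow D φ M ε δ ρ r₁ r₂ Λ :=
  fun _ hv => hv.1

/-- The same, in closed form (registered sub-goal of stmt-CriticalPhenomena-10650). [folklore] -/
theorem annSide_subset_annWindow' : ∀ (D : DobrushinDomain) (φ : ConformalEquiv upperHalfPlaneSet D.carrier) (M ε δ ρ r₁ r₂ : ℝ) (Λ : Finset (Site 2)) (left : Bool), annSide D φ M ε δ ρ r₁ r₂ Λ left ⊆ annWindow D φ M ε δ ρ r₁ r₂ Λ :=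
  annSide_subset_annWindow

/-- **Open side-to-side crossing**: an `ω`-open walk of `H` inside `W` from a site of `L` to a site of
`R` (for the window `W` and its two rough sides: CDH16's crossing event `(ab) ↔ (cd)`). [folklore] -/
def AnnSideCross (H : SimpleGraph Λ) (W L R : Set Λ) (ω : BondConfig Λ) : Prop :=
  ∃ u ∈ L, ∃ v ∈ R, ∃ p : H.Walk u v, (∀ z ∈ p.support, z ∈ W) ∧ ∀ e ∈ p.edges, e ∈ ω

/-- `AnnSideCross` is increasing in the configuration. [folklore] -/
theorem annSideCross_mono {H : SimpleGraph Λ} {W L R : Set Λ} {ω ω' : BondConfig Λ} (h : ω ⊆ ω')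
    (hω : AnnSideCross H W L R ω) : AnnSideCross H W L R ω' := by
  obtain ⟨u, hu, v, hv, p, hsupp, hopen⟩ := hω
  exact ⟨u, hu, v, hv, p, hsupp, fun e he => h (hopen e he)⟩

/-- `AnnSideCross` is monotone in the three sets. [folklore] -/
theorem annSideCross_mono_sets {H : SimpleGraph Λ} {W W' L L' R R' : Set Λ} (hW : W ⊆ W') (hL : L ⊆ L')
    (hR : R ⊆ R') {ω : BondConfig Λ} (hω : AnnSideCross H W L R ω) : AnnSideCross H W' L' R' ω := by
  obtain ⟨u, hu, v, hv, p, hsupp, hopen⟩ := hω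
  exact ⟨u, hL hu, v, hR hv, p, fun z hz => hW (hsupp z hz), hopen⟩

end Events

/-- **Side-to-side crossings separate** (TARGET; planar topology of `Ω_δ` in the chordal chart, no
probability). For the chordal chart `φ` of `(D; a, b)`, `M > 1` and `ε > 0` there is `ρ₀ > 0` such that
for every scale `ρ < ρ₀`, every window `ρ < r₁ ≤ r₂ < Mρ` and all small `δ`, in every finite volume `Λ`:
an `ω`-open walk of `H = Ω_δ|_Λ` inside the window `annWindow … r₁ r₂` from its left rough side to its right
rough side is an `AnnPathSep` separator — its support meets every walk of `H` from `annIn`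
to the complement of `annIn ∪ annBody`. (`ρ₀`: `φ({|w| < Mρ₀}) ⊆ B(a, ε)`, so that leaving
`annIn ∪ annBody` means reaching chart radius `≥ Mρ`; small `δ`: the chart oscillation over `5δ` is below
the margins `r₁ - ρ`, `Mρ - r₂`, so that the cross-cut obtained by prolonging the crossing to `∂D` through
mesh-avoiding access paths at its two boundary end-vertices has chart image inside `{ρ < |w| < Mρ}` with
feet on `ℝ₋` and `ℝ₊`; then Maehara's crossing lemma in the coordinates `(log |w|, arg w)`.) -/
def AnnSideCrossSeparation : Prop :=
  ∀ (D : DobrushinDomain) (φ : ConformalEquiv upperHalfPlaneSet D.carrier),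
    D.IsChordalUniformizing φ → ∀ (M : ℝ), 1 < M → ∀ (ε : ℝ), 0 < ε →
      ∃ ρ₀ : ℝ, 0 < ρ₀ ∧ ∀ (ρ r₁ r₂ : ℝ), 0 < ρ → ρ < ρ₀ → ρ < r₁ → r₁ ≤ r₂ → r₂ < M * ρ →
        ∀ᶠ δ in 𝓝[>] (0 : ℝ), ∀ (Λ : Finset (Site 2)),
          let H : SimpleGraph Λ := (discreteDomainGraph D.carrier δ).comap Subtype.val
          let In : Set Λ := annIn D φ ε δ ρ Λ
          let Ann : Set Λ := annBody D φ M ε δ ρ Λ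
          ∀ ω : BondConfig Λ,
            AnnSideCross H (annWindow D φ M ε δ ρ r₁ r₂ Λ) (annSide D φ M ε δ ρ r₁ r₂ Λ true)
                (annSide D φ M ε δ ρ r₁ r₂ Λ false) ω →
              AnnPathSep H In Ann ω

/-- **One ball-component at the marked prime end** (TARGET; lattice topology of `Ω_δ`, no probability).
For the chordal chart `φ` of `(D; a, b)` and `ε > 0` there is `R₀ > 0` such that for every `R < R₀` and
all small `δ`, any two vertices of the mesh graph `Ω_δ` of chart radius `< R` are joined by a walk of
`Ω_δ` all of whose vertices have mesh point in `B(a, ε)`. (With `LocalAgreement` this makes a finite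
volume seeing one vertex of the inside see the whole lattice half-annulus; it is the "one
ball-component" lemma behind the guard `AnnLink` of the stub.) -/
def ChartDiscOneComponent : Prop :=
  ∀ (D : DobrushinDomain) (φ : ConformalEquiv upperHalfPlaneSet D.carrier),
    D.IsChordalUniformizing φ → ∀ (ε : ℝ), 0 < ε → ∃ R₀ : ℝ, 0 < R₀ ∧ ∀ (R : ℝ), 0 < R → R < R₀ →
      ∀ᶠ δ in 𝓝[>] (0 : ℝ), ∀ x ∈ meshDomain D.carrier δ, ∀ y ∈ meshDomain D.carrier δ,
        ‖φ.symm (meshPoint δ x)‖ < R → ‖φ.symm (meshPoint δ y)‖ < R →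
          ∃ w : (discreteDomainGraph D.carrier δ).Walk x y,
            ∀ z ∈ w.support, meshPoint δ z ∈ Metric.ball (D.pt 0) ε

/-- **Lower bound for the side-to-side crossing** (TARGET; Chelkak–Duminil-Copin–Hongler 2016 Thm 1.1 (i)
with Remark 2.2 for the discrete topological rectangle carved out of the annulus sites, rough sides as
marked arcs, plus the bound on its discrete extremal length in terms of `M` for small `δ`, Chelkak's
toolbox Prop. 6.2 / Cor. 6.3). For the chordal chart `φ` and `M > 1` there is `c > 0` such that for every
`ε` there is `ρ₀ > 0` with: for every `ρ < ρ₀`, all small `δ` and every finite volume `Λ` closed under the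
`Ω_δ`-neighbours of its sites in `B(a, ε)` (`LocalAgreement` for `Ω_δ`) and containing every vertex of
`Ω_δ` of chart radius `< Mρ` (so that `H = Ω_δ|_Λ` carries the whole lattice half-annulus and its rims),
the FREE critical FK-Ising measure of the local graph `⟨U⟩` (`U = annEdgeFinset H Ann`, vertex type `↥Λ`)
gives the open side-to-side crossing of the window `[M^{1/4} ρ, M^{3/4} ρ]` probability `≥ c`. -/
def HalfAnnulusSideCrossingBound : Prop :=
  ∀ (D : DobrushinDomain) (φ : ConformalEquiv upperHalfPlaneSet D.carrier),
    D.IsChordalUniformizing φ → ∀ (M : ℝ), 1 < M → ∃ c : ℝ, 0 < c ∧ ∀ (ε : ℝ), 0 < ε →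
      ∃ ρ₀ : ℝ, 0 < ρ₀ ∧ ∀ (ρ : ℝ), 0 < ρ → ρ < ρ₀ → ∀ᶠ δ in 𝓝[>] (0 : ℝ),
        ∀ (Λ : Finset (Site 2)),
          LocalAgreement D.carrier (D.pt 0) ε δ (discreteDomainGraph D.carrier δ) Λ →
            let H : SimpleGraph Λ := (discreteDomainGraph D.carrier δ).comap Subtype.val
            let Ann : Set Λ := annBody D φ M ε δ ρ Λ
            let s : ℝ := Real.sqrt (Real.sqrt M)
            (∀ x ∈ meshDomain D.carrier δ, ‖φ.symm (meshPoint δ x)‖ < M * ρ → x ∈ Λ) →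
              c ≤ (rcMeasure (fromEdgeSet (↑(annEdgeFinset H Ann) : Set (Sym2 Λ)))
                  (1 - Real.exp (-2 * criticalBetaTwo)) 2 ∅).real
                {ω | AnnSideCross H (annWindow D φ M ε δ ρ (s * ρ) (M * ρ / s) Λ)
                  (annSide D φ M ε δ ρ (s * ρ) (M * ρ / s) Λ true)
                  (annSide D φ M ε δ ρ (s * ρ) (M * ρ / s) Λ false) ω}

/-- **Upper bound for the rim-to-rim crossing** (TARGET; Chelkak–Duminil-Copin–Hongler 2016 Thm 1.1 (ii)
with Remark 2.2, the two rims as marked arcs, plus the extremal-length bound). For the chordal chart `φ`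
and `M > 1` there is `c > 0` such that for every `ε` there is `ρ₀ > 0` with: for every `ρ < ρ₀`, all
small `δ` and every finite volume `Λ` closed under the `Ω_δ`-neighbours of its sites in `B(a, ε)`, the
critical FK-Ising measure of the local graph `⟨U⟩` with ALL vertices off the annulus wired into one class
gives the open radial crossing `AnnCross` probability `≤ 1 - c`. (Literally the second clause of
`RoughHalfAnnulusRSWMeshOf`.) -/
def HalfAnnulusRimCrossingBound : Prop :=
  ∀ (D : DobrushinDomain) (φ : ConformalEquiv upperHalfPlaneSet D.carrier),
    D.IsChordalUniformizing φ → ∀ (M : ℝ), 1 < M → ∃ c : ℝ, 0 < c ∧ ∀ (ε : ℝ), 0 < ε →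
      ∃ ρ₀ : ℝ, 0 < ρ₀ ∧ ∀ (ρ : ℝ), 0 < ρ → ρ < ρ₀ → ∀ᶠ δ in 𝓝[>] (0 : ℝ),
        ∀ (Λ : Finset (Site 2)),
          LocalAgreement D.carrier (D.pt 0) ε δ (discreteDomainGraph D.carrier δ) Λ →
            let H : SimpleGraph Λ := (discreteDomainGraph D.carrier δ).comap Subtype.val
            let In : Set Λ := annIn D φ ε δ ρ Λ
            let Ann : Set Λ := annBody D φ M ε δ ρ Λ
            (rcMeasure (fromEdgeSet (↑(annEdgeFinset H Ann) : Set (Sym2 Λ)))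
                (1 - Real.exp (-2 * criticalBetaTwo)) 2 Annᶜ).real {ω | AnnCross H In Ann ω} ≤ 1 - c

end Summit.CriticalPhenomena.SAWScalingLimit.Theorems.IsingBoundaryRatio

end
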